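import Mathlib
import Summits.Ventures.PercRepro2.SepSplitTerm
import Summits.Ventures.PercRepro2.SepFarA3Gen

/-!
# Gluing at a general separator, X: the realised-orbit rule for ANY terminals and ANY kernel of
their connectivity (blind cell PercRepro2, mine-2 g48, 2026-08-29; `conjectures/MINE-2.md` M2-98)

The far-side counts of `SepSplitTerm` are nonnegative and copy-symmetric (`farCountT_nonneg`,
`farCountT_swap12/23/13/cyc/cyc'` — properties of the exact indicators, independent of the kernel),
so the abstract rule `nonneg_of_orbit_sumsG` applies to `typedCount_eq_sepSplitT`: **the typed
count of any kernel `KZ` of the terminal connectivities is nonnegative as soon as every REALISED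
`S₃`-orbit sum of the glued root counts of `KZ` is** (`typedCount_nonneg_of_sepSplitT_realised`).
Row 2′TRI's rule (`typedCount_nonneg_of_sepSplit_realised`) is the case `ζ = Fin 5`,
`KZ = KB ∘ st7`.  Own work; standard axioms.
-/

namespace Summit.Ventures.PercRepro2

open UnionCluster

namespace CovForm

namespace RootBridge

open OneTyped TypedA3 Untouched TypedFactor Separated

/-! ## The far-side counts and their copy symmetries -/

section FarCounts

open Classical

variable {V : Type*} {E : Type*} {ι ζ : Type*} [Fintype E] [DecidableEq E] {R : Type*} [Field R]
  [LinearOrder R] [IsStrictOrderedRing R]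
variable (ends : E → Sym2 V) (Z : ζ → V) (σ : ι → V) (VL : Set V)

/-- The far-side counts on the terminals are nonnegative. -/
lemma farCountT_nonneg (A : Finset E) (z : Config E) (τ : E → ℕ) (p : Pat3T ι ζ) :
    (0 : R) ≤ typedCount A z τ (farKT ends Z σ VL p) := by
  refine typedCount_nonneg_of_nonneg _ _ _ fun x y w => ?_
  unfold farKT
  push_cast
  refine mul_nonneg (mul_nonneg ?_ ?_) ?_ <;> exact_mod_cast exactT_nonneg _ _

omit [LinearOrder R] [IsStrictOrderedRing R] in
/-- Copy symmetry of the far-side counts: the first two copies. -/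
lemma farCountT_swap12 (A : Finset E) (z : Config E) (τ : E → ℕ) (p : Pat3T ι ζ) :
    typedCount A z τ (farKT ends Z σ VL (p.2.1, p.1, p.2.2) : Config E → Config E → Config E → R) =
      typedCount A z τ (farKT ends Z σ VL p) := by
  rw [← typedCount_swap12 A z τ (farKT ends Z σ VL p)]
  exact typedCount_congr' _ _ _ _ _ fun x y w => by unfold farKT; push_cast; ring

omit [LinearOrder R] [IsStrictOrderedRing R] in
/-- Copy symmetry of the far-side counts: the last two copies (types in `{1, 2}`). -/
lemma farCountT_swap23 (A : Finset E) (z : Config E) (τ : E → ℕ) (hτ : ∀ e ∈ A, τ e = 1 ∨ τ e = 2)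
    (p : Pat3T ι ζ) :
    typedCount A z τ (farKT ends Z σ VL (p.1, p.2.2, p.2.1) : Config E → Config E → Config E → R) =
      typedCount A z τ (farKT ends Z σ VL p) := by
  rw [← typedCount_swap23 A z τ hτ (farKT ends Z σ VL p)]
  exact typedCount_congr' _ _ _ _ _ fun x y w => by unfold farKT; push_cast; ring

omit [LinearOrder R] [IsStrictOrderedRing R] in
/-- Copy symmetry of the far-side counts: the first and third copies (types in `{1, 2}`). -/
lemma farCountT_swap13 (A : Finset E) (z : Config E) (τ : E → ℕ) (hτ : ∀ e ∈ A, τ e = 1 ∨ τ e = 2)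
    (p : Pat3T ι ζ) :
    typedCount A z τ (farKT ends Z σ VL (p.2.2, p.2.1, p.1) : Config E → Config E → Config E → R) =
      typedCount A z τ (farKT ends Z σ VL p) := by
  rw [← typedCount_swap13 A z τ hτ (farKT ends Z σ VL p)]
  exact typedCount_congr' _ _ _ _ _ fun x y w => by unfold farKT; push_cast; ring

omit [LinearOrder R] [IsStrictOrderedRing R] in
/-- Copy symmetry of the far-side counts: the cyclic shift `(p₁, p₂, p₃) ↦ (p₂, p₃, p₁)`. -/
lemma farCountT_cyc (A : Finset E) (z : Config E) (τ : E → ℕ) (hτ : ∀ e ∈ A, τ e = 1 ∨ τ e = 2)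
    (p : Pat3T ι ζ) :
    typedCount A z τ (farKT ends Z σ VL (p.2.1, p.2.2, p.1) : Config E → Config E → Config E → R) =
      typedCount A z τ (farKT ends Z σ VL p) := by
  have h1 := typedCount_swap12 A z τ (fun x y w => farKT ends Z σ VL p w y x : Config E →
    Config E → Config E → R)
  have h2 := typedCount_swap13 A z τ hτ (farKT ends Z σ VL p : Config E → Config E → Config E → R)
  rw [← h2, ← h1]
  exact typedCount_congr' _ _ _ _ _ fun x y w => by unfold farKT; push_cast; ring

omit [LinearOrder R] [IsStrictOrderedRing R] in
/-- Copy symmetry of the far-side counts: the cyclic shift `(p₁, p₂, p₃) ↦ (p₃, p₁, p₂)`. -/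
lemma farCountT_cyc' (A : Finset E) (z : Config E) (τ : E → ℕ) (hτ : ∀ e ∈ A, τ e = 1 ∨ τ e = 2)
    (p : Pat3T ι ζ) :
    typedCount A z τ (farKT ends Z σ VL (p.2.2, p.1, p.2.1) : Config E → Config E → Config E → R) =
      typedCount A z τ (farKT ends Z σ VL p) := by
  have h1 := typedCount_swap12 A z τ (fun x y w => farKT ends Z σ VL p x w y : Config E →
    Config E → Config E → R)
  have h2 := typedCount_swap23 A z τ hτ (farKT ends Z σ VL p : Config E → Config E → Config E → R)
  rw [← h2, ← h1]
  exact typedCount_congr' _ _ _ _ _ fun x y w => by unfold farKT; push_cast; ring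

end FarCounts


/-! ## The rule on the realised orbits -/

section Rule

open Classical

variable {V : Type*} {E : Type*} {ι ζ : Type*} [Fintype E] [DecidableEq E] [Fintype ι]
  [DecidableEq ι] [Fintype ζ] [DecidableEq ζ] {R : Type*} [Field R] [LinearOrder R]
  [IsStrictOrderedRing R]
variable (ends : E → Sym2 V) (Z : ζ → V) (σ : ι → V)
  (KZ : (ζ → ζ → Bool) → (ζ → ζ → Bool) → (ζ → ζ → Bool) → ℤ)

/-- The `S₃`-orbit sum of the root-side counts of `KZ` of a data triple (the six copy
permutations). -/
noncomputable def orbitRootT (side : ζ → Bool) (VH : Set V) (B : Finset E) (z : Config E)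
    (τ : E → ℕ) (p : Pat3T ι ζ) : R :=
  orbitSumG (fun q => typedCount B z τ (rootKT ends Z σ KZ side VH q)) p

omit [LinearOrder R] [IsStrictOrderedRing R] in
/-- Pairing the far-side counts with a permuted root count gives the same sum. -/
lemma sum_far_root_permT (side : ζ → Bool) (VL VH : Set V) (A B : Finset E) (z : Config E)
    (τ : E → ℕ) (f : Pat3T ι ζ → Pat3T ι ζ) (hf : Function.Bijective f)
    (hσ : ∀ p, typedCount A z τ
        (farKT ends Z σ VL (f p) : Config E → Config E → Config E → R) =
      typedCount A z τ (farKT ends Z σ VL p)) :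
    (∑ p : Pat3T ι ζ,
        typedCount A z τ (farKT ends Z σ VL p : Config E → Config E → Config E → R) *
          typedCount B z τ (rootKT ends Z σ KZ side VH (f p))) =
      ∑ p : Pat3T ι ζ,
        typedCount A z τ (farKT ends Z σ VL p : Config E → Config E → Config E → R) *
          typedCount B z τ (rootKT ends Z σ KZ side VH p) := by
  refine Fintype.sum_bijective f hf _ _ fun p => ?_
  rw [hσ p]

/-- **Nonnegativity of the typed count of any connectivity kernel at a split, from the REALISED
orbits**: it suffices that the `S₃`-orbit sums of the glued root-side counts of `KZ` be
nonnegative on the data triples whose far-side count is nonzero. -/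
theorem typedCount_nonneg_of_sepSplitT_realised {side : ζ → Bool} {VL VH : Set V}
    (F : Finset E) (z : Config E) (τ : E → ℕ) (hτ : ∀ e ∈ F, τ e = 1 ∨ τ e = 2)
    (h : SepSplitT ends Z σ side VL VH F z)
    (hroot : ∀ p : Pat3T ι ζ,
      typedCount (sideF ends VL F) z τ
          (farKT ends Z σ VL p : Config E → Config E → Config E → R) ≠ 0 →
      (0 : R) ≤ orbitRootT ends Z σ KZ side VH (sideF ends VH F) z τ p) :
    0 ≤ typedCount F z τ (fun x y w =>
      ((KZ (connData ends Z x) (connData ends Z y) (connData ends Z w) : ℤ) : R)) := by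
  rw [typedCount_eq_sepSplitT ends Z σ KZ F z τ h]
  have hτA : ∀ e ∈ sideF ends VL F, τ e = 1 ∨ τ e = 2 :=
    fun e he => hτ e (Finset.filter_subset _ _ he)
  refine mul_nonneg ?_ (typedCount_nonneg_of_nonneg _ _ _ fun _ _ _ => zero_le_one)
  refine nonneg_of_orbit_sumsG
    (fun p => typedCount (sideF ends VL F) z τ (farKT ends Z σ VL p))
    (fun p => typedCount (sideF ends VH F) z τ (rootKT ends Z σ KZ side VH p))
    (fun p => farCountT_nonneg ends Z σ VL _ z τ p) ?_ ?_ ?_ ?_ ?_ hroot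
  · exact sum_far_root_permT ends Z σ KZ side VL VH _ _ z τ _
      (Function.Involutive.bijective fun _ => rfl)
      (fun p => farCountT_swap12 ends Z σ VL _ z τ p)
  · exact sum_far_root_permT ends Z σ KZ side VL VH _ _ z τ _
      (Function.Involutive.bijective fun _ => rfl)
      (fun p => farCountT_swap23 ends Z σ VL _ z τ hτA p)
  · exact sum_far_root_permT ends Z σ KZ side VL VH _ _ z τ _
      (Function.Involutive.bijective fun _ => rfl)
      (fun p => farCountT_swap13 ends Z σ VL _ z τ hτA p)
  · exact sum_far_root_permT ends Z σ KZ side VL VH _ _ z τ _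
      (Function.bijective_iff_has_inverse.mpr
        ⟨fun p => (p.2.2, p.1, p.2.1), fun _ => rfl, fun _ => rfl⟩)
      (fun p => farCountT_cyc ends Z σ VL _ z τ hτA p)
  · exact sum_far_root_permT ends Z σ KZ side VL VH _ _ z τ _
      (Function.bijective_iff_has_inverse.mpr
        ⟨fun p => (p.2.1, p.2.2, p.1), fun _ => rfl, fun _ => rfl⟩)
      (fun p => farCountT_cyc' ends Z σ VL _ z τ hτA p)

end Rule

end RootBridge

end CovForm

end Summit.Ventures.PercRepro2
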